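import Mathlib
import Literature.MathematicalPhysics.QuantumFieldTheory.Luscher2010.TrivializingMaps
import Literature.MathematicalPhysics.QuantumFieldTheory.Luscher2010.FlowActionSeries
import Summits.Ventures.LatticeQCDFlow.TrivializingMaps.LinkPolynomials
import Summits.Ventures.LatticeQCDFlow.TrivializingMaps.WilsonPolynomials
import Summits.Ventures.LatticeQCDFlow.TrivializingMaps.SeriesGradientBound
import HarnessLib

/-!
# Wilson-loop actions as link polynomials: degree = loop length, support = a plaquette ball

HONEST FRAMING: exact (Metropolis-corrected) sampling algorithms for lattice gauge theory; figures of merit are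
autocorrelation/cost numbers at stated couplings and volumes; no continuum-physics claim.

Lüscher, CMP 293 (2010) 899, §4 (preamble) and §4.4 eq. (4.19): the actions of §4 are "a sum of Wilson loops
(plaquettes, rectangles, etc.)", `S(U) = ∑_x ∑_{C ∈ 𝒞} Re (c_C tr U(C_x))` — the tree's `loopAction shapes coef`
with `pathProd W x w` the ordered product `U(C)` along the word `w` started at `x`
(`Literature/…/Luscher2010/FlowActionSeries.lean`). This file supplies, sorry-free and with NO new definitions,
the polynomial / locality bookkeeping for such actions that the Wilson plaquette action got in
`WilsonPolynomials` — the input of the anchored Lüscher recursion for a GENERAL loop action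
(file `LoopActionSeries`, discharging the cited `LuscherSeriesLocal`):

* §1 geometry of the plaquette-adjacency balls `linkBall R e` in dimension `d ≥ 2`: monotonicity, the
  triangle inequality `linkBall_add`, and "one lattice step costs radius ≤ 2" (`site_mem_linkBall_one`,
  `shift_mem_linkBall_two`, `sub_mem_linkBall_two`);
* §2 `pathProd_mem`: `W ↦ U(C_x)` for a word of length `ℓ` is a matrix of link polynomials of degree `≤ ℓ`
  supported in `linkBall (2ℓ) (x, ν)` (any anchor direction `ν`);
* §3 the site term `s_x = ∑_{C ∈ 𝒞} Re(c_C tr U(C_x))` lies in `PD ℓ (linkBall (2ℓ) (x,ν))` (`loopSite_mem`),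
  `loopAction = ∑_x s_x` (`loopAction_eq_sum_site`), a link derivative `∂_{e',X} S` lies in
  `PD ℓ (linkBall (4ℓ) e')` (`linkDeriv_loopAction_mem`), and `S` is smooth.

In `d ≤ 1` there are no plaquettes, `linkBall R e = {e}`, and the support statements are false ambiently
(they hold on `SU(n)^E` only because closed words have trivial holonomy on a line); that case is treated
separately in `LoopActionSeriesLowDim`.

References: M. Lüscher, CMP 293 (2010) 899 [Luscher2010Trivializing, arXiv:0907.5491], §4 preamble, §4.4
eq. (4.19), §4.5(a)–(b).
-/

namespace Summit.Ventures.LatticeQCDFlow.TrivializingMaps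

open Literature.MathematicalPhysics.QuantumFieldTheory
open Literature.MathematicalPhysics.QuantumFieldTheory.Luscher2010
open scoped Matrix Matrix.Norms.Frobenius ContDiff

noncomputable section

variable {d L n : ℕ}

/-! ## §1. Geometry of plaquette balls (`d ≥ 2`) -/

/-- Plaquette balls grow with the radius. [folklore] -/
theorem linkBall_mono {R R' : ℕ} (h : R ≤ R') (e : Edge d L) : linkBall R e ⊆ linkBall R' e := by
  induction h with
  | refl => exact subset_rfl
  | step _ ih => exact ih.trans (linkBall_subset_succ _ e)

/-- **Triangle inequality** for plaquette balls: `e' ∈ B_R(e)`, `e'' ∈ B_{R'}(e')` ⟹ `e'' ∈ B_{R+R'}(e)`.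
[folklore] -/
theorem linkBall_add {R R' : ℕ} {e e' e'' : Edge d L} (h : e' ∈ linkBall R e)
    (h' : e'' ∈ linkBall R' e') : e'' ∈ linkBall (R + R') e := by
  induction R' generalizing e'' with
  | zero =>
      rw [mem_linkBall_zero] at h'
      subst h'
      simpa using h
  | succ R' ih =>
      rw [mem_linkBall_succ] at h'
      obtain ⟨e₁, he₁, hP⟩ := h'
      show e'' ∈ linkBall (R + R' + 1) e
      rw [mem_linkBall_succ]
      exact ⟨e₁, ih he₁, hP⟩

/-- Two links at the same site are plaquette-adjacent (or equal): `(y, ν') ∈ B_1(y, ν)`. [folklore] -/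
theorem site_mem_linkBall_one (y : Site d L) (ν ν' : Fin d) : (y, ν') ∈ linkBall 1 (y, ν) := by
  by_cases h : ν' = ν
  · subst h; exact self_mem_linkBall 1 _
  · refine plaqNbhd_subset_linkBall_one _ ?_
    exact ⟨y, ν, ν', Ne.symm h, self_mem_plaqLinks y ν ν', by simp [plaqLinks]⟩

/-- In dimension `d ≥ 2` every direction has a different one. [folklore] -/
theorem exists_ne_dir (hd : 2 ≤ d) (ν : Fin d) : ∃ ρ : Fin d, ρ ≠ ν := by
  haveI : Nontrivial (Fin d) := Fin.nontrivial_iff_two_le.mpr hd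
  exact exists_ne ν

/-- **A forward lattice step costs radius ≤ 2**: `(y + μ̂, ν') ∈ B_2(y, ν)` (`d ≥ 2`). [folklore] -/
theorem shift_mem_linkBall_two (hd : 2 ≤ d) (y : Site d L) (ν μ ν' : Fin d) :
    (y.shift μ, ν') ∈ linkBall 2 (y, ν) := by
  by_cases hμν : μ = ν
  · subst hμν
    obtain ⟨ρ, hρ⟩ := exists_ne_dir hd μ
    have h1 : (y.shift μ, ρ) ∈ linkBall 1 (y, μ) :=
      plaqNbhd_subset_linkBall_one _ ⟨y, μ, ρ, Ne.symm hρ, self_mem_plaqLinks y μ ρ, by simp [plaqLinks]⟩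
    exact linkBall_add h1 (site_mem_linkBall_one (y.shift μ) ρ ν')
  · have h1 : (y.shift μ, ν) ∈ linkBall 1 (y, ν) :=
      plaqNbhd_subset_linkBall_one _ ⟨y, ν, μ, Ne.symm hμν, self_mem_plaqLinks y ν μ, by simp [plaqLinks]⟩
    exact linkBall_add h1 (site_mem_linkBall_one (y.shift μ) ν ν')

/-- **A backward lattice step costs radius ≤ 2**: `(y - μ̂, ν') ∈ B_2(y, ν)` (`d ≥ 2`; symmetry of the ball).
[folklore] -/
theorem sub_mem_linkBall_two (hd : 2 ≤ d) (y : Site d L) (ν μ ν' : Fin d) :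
    (y - Pi.single μ 1, ν') ∈ linkBall 2 (y, ν) := by
  have hy : (y - Pi.single μ 1).shift μ = y := by simp [Site.shift]
  have h := shift_mem_linkBall_two hd (y - Pi.single μ 1) ν' μ ν
  rw [hy] at h
  exact (mem_linkBall_comm 2 _ _).1 h

/-! ## §2. Loop products are matrices of link polynomials -/

/-- `cxPart` is monotone. [folklore] -/
theorem cxPart_mono {P Q : Submodule ℝ (AmbConfig d L n → ℝ)} (h : P ≤ Q) : cxPart P ≤ cxPart Q :=
  fun _ hF => ⟨h hF.1, h hF.2⟩

/-- `matPart` is monotone. [folklore] -/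
theorem matPart_mono {P Q : Submodule ℝ (AmbConfig d L n → ℝ)} (h : P ≤ Q) : matPart P ≤ matPart Q :=
  fun _ hM i j => cxPart_mono h (hM i j)

/-- The trace of a matrix functional with entries over `P` has real and imaginary parts in `P`. [folklore] -/
theorem cx_trace_mem {P : Submodule ℝ (AmbConfig d L n → ℝ)}
    {M : AmbConfig d L n → Matrix (Fin n) (Fin n) ℂ} (hM : M ∈ matPart P) :
    (fun W => (M W).trace) ∈ cxPart P := by
  have e : (fun W => (M W).trace) = ∑ i, fun W => M W i i := by
    funext W; simp only [Matrix.trace, Matrix.diag_apply, Finset.sum_apply]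
  rw [e]; exact Submodule.sum_mem _ fun i _ => hM i i

/-- Unfolding `pathProd` on a forward step. [cite: Luscher2010Trivializing, §4.4 eq. (4.19)] -/
theorem pathProd_cons_true (W : AmbConfig d L n) (x : Site d L) (μ : Fin d) (w : PathWord d) :
    pathProd W x ((μ, true) :: w) = W (x, μ) * pathProd W (x.shift μ) w := rfl

/-- Unfolding `pathProd` on a backward step. [cite: Luscher2010Trivializing, §4.4 eq. (4.19)] -/
theorem pathProd_cons_false (W : AmbConfig d L n) (x : Site d L) (μ : Fin d) (w : PathWord d) :
    pathProd W x ((μ, false) :: w) = (W (x - Pi.single μ 1, μ))ᴴ * pathProd W (x - Pi.single μ 1) w := rfl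

/-- Unfolding `pathProd` on the empty word. [cite: Luscher2010Trivializing, §4.4 eq. (4.19)] -/
theorem pathProd_nil (W : AmbConfig d L n) (x : Site d L) : pathProd W x [] = 1 := rfl

/-- **`U(C_x)` is a matrix of link polynomials of degree `≤ |C|` supported in the plaquette ball of radius
`2|C|` around `(x, ν)`** (`d ≥ 2`, any anchor direction `ν`). [cite: Luscher2010Trivializing, §4.4] -/
theorem pathProd_mem (hd : 2 ≤ d) : ∀ (w : PathWord d) (x : Site d L) (ν : Fin d),
    (fun W : AmbConfig d L n => pathProd W x w) ∈
      matPart (PD w.length (linkBall (2 * w.length) (x, ν)))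
  | [], x, ν => mat_const_mem (n := n) 0 (linkBall 0 (x, ν)) 1
  | (μ, true) :: w, x, ν => by
      have h1 : (fun W : AmbConfig d L n => W (x, μ)) ∈
          matPart (PD 1 (linkBall (2 * (w.length + 1)) (x, ν))) :=
        mat_link_mem le_rfl (linkBall_mono (by omega) _ (site_mem_linkBall_one x ν μ))
      have hsub : linkBall (2 * w.length) (x.shift μ, μ) ⊆ linkBall (2 * (w.length + 1)) (x, ν) :=
        fun e he => linkBall_mono (by omega) _ (linkBall_add (shift_mem_linkBall_two hd x ν μ μ) he)
      have h2 : (fun W : AmbConfig d L n => pathProd W (x.shift μ) w) ∈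
          matPart (PD w.length (linkBall (2 * (w.length + 1)) (x, ν))) :=
        matPart_mono (PD_mono le_rfl hsub) (pathProd_mem hd w (x.shift μ) μ)
      exact mat_mul_mem (a := 1) (b := w.length) (c := w.length + 1) (by omega) h1 h2
  | (μ, false) :: w, x, ν => by
      have h1 : (fun W : AmbConfig d L n => (W (x - Pi.single μ 1, μ))ᴴ) ∈
          matPart (PD 1 (linkBall (2 * (w.length + 1)) (x, ν))) :=
        mat_conjTranspose_mem
          (mat_link_mem le_rfl (linkBall_mono (by omega) _ (sub_mem_linkBall_two hd x ν μ μ)))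
      have hsub : linkBall (2 * w.length) (x - Pi.single μ 1, μ) ⊆ linkBall (2 * (w.length + 1)) (x, ν) :=
        fun e he => linkBall_mono (by omega) _ (linkBall_add (sub_mem_linkBall_two hd x ν μ μ) he)
      have h2 : (fun W : AmbConfig d L n => pathProd W (x - Pi.single μ 1) w) ∈
          matPart (PD w.length (linkBall (2 * (w.length + 1)) (x, ν))) :=
        matPart_mono (PD_mono le_rfl hsub) (pathProd_mem hd w (x - Pi.single μ 1) μ)
      exact mat_mul_mem (a := 1) (b := w.length) (c := w.length + 1) (by omega) h1 h2

/-! ## §3. The site terms of a loop action -/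

/-- **The site term `s_x = ∑_{C ∈ 𝒞} Re(c_C tr U(C_x))` is a link polynomial of degree `≤ ℓ` supported in
`linkBall (2ℓ) (x, ν)`**, `ℓ` any bound on the loop lengths (`d ≥ 2`). [cite: Luscher2010Trivializing, §4.4 eq. (4.19)] -/
theorem loopSite_mem (hd : 2 ≤ d) (shapes : Finset (PathWord d)) (coef : PathWord d → ℂ) {ℓ : ℕ}
    (hℓ : ∀ w ∈ shapes, w.length ≤ ℓ) (x : Site d L) (ν : Fin d) :
    (fun W : AmbConfig d L n => ∑ w ∈ shapes, (coef w * (pathProd W x w).trace).re) ∈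
      PD ℓ (linkBall (2 * ℓ) (x, ν)) := by
  have e : (fun W : AmbConfig d L n => ∑ w ∈ shapes, (coef w * (pathProd W x w).trace).re) =
      ∑ w ∈ shapes, fun W => (coef w * (pathProd W x w).trace).re := by
    funext W; simp only [Finset.sum_apply]
  rw [e]
  refine Submodule.sum_mem _ fun w hw => ?_
  have hP : (fun W : AmbConfig d L n => pathProd W x w) ∈ matPart (PD ℓ (linkBall (2 * ℓ) (x, ν))) :=
    matPart_mono (PD_mono (hℓ w hw) (linkBall_mono (by have := hℓ w hw; omega) _)) (pathProd_mem hd w x ν)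
  have hc : (fun W : AmbConfig d L n => coef w * (pathProd W x w).trace) ∈
      cxPart (PD ℓ (linkBall (2 * ℓ) (x, ν))) :=
    cx_mul_mem (a := 0) (b := ℓ) (c := ℓ) (by omega) (cx_const_mem 0 _ (coef w)) (cx_trace_mem hP)
  exact hc.1

variable [NeZero L]

/-- `S = ∑_x s_x`: a loop action is the sum of its site terms. [cite: Luscher2010Trivializing, §4.4 eq. (4.19)] -/
theorem loopAction_eq_sum_site (shapes : Finset (PathWord d)) (coef : PathWord d → ℂ) :
    (loopAction shapes coef : AmbConfig d L n → ℝ) =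
      fun W => ∑ x : Site d L, (fun W' : AmbConfig d L n => ∑ w ∈ shapes, (coef w * (pathProd W' x w).trace).re) W :=
  rfl

/-- A loop action is a link polynomial of degree `≤ ℓ` (`d ≥ 2`). [cite: Luscher2010Trivializing, §4.4] -/
theorem loopAction_mem_polyL (hd : 2 ≤ d) (shapes : Finset (PathWord d)) (coef : PathWord d → ℂ) {ℓ : ℕ}
    (hℓ : ∀ w ∈ shapes, w.length ≤ ℓ) : (loopAction shapes coef : AmbConfig d L n → ℝ) ∈ polyL d L n ℓ := by
  obtain ⟨ν⟩ : Nonempty (Fin d) := ⟨⟨0, by omega⟩⟩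
  rw [loopAction_eq_sum_site]
  have h : (fun W : AmbConfig d L n => ∑ x : Site d L,
      (fun W' : AmbConfig d L n => ∑ w ∈ shapes, (coef w * (pathProd W' x w).trace).re) W) =
      ∑ x : Site d L, fun W' : AmbConfig d L n => ∑ w ∈ shapes, (coef w * (pathProd W' x w).trace).re := by
    funext W; simp only [Finset.sum_apply]
  rw [h]
  exact Submodule.sum_mem _ fun x _ => (loopSite_mem hd shapes coef hℓ x ν).1

/-- A loop action is smooth on ambient configurations (`d ≥ 2`). [folklore] -/
theorem contDiff_loopAction (hd : 2 ≤ d) (shapes : Finset (PathWord d)) (coef : PathWord d → ℂ) :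
    ContDiff ℝ ∞ (loopAction shapes coef : AmbConfig d L n → ℝ) :=
  contDiff_of_mem_polyL (loopAction_mem_polyL hd shapes coef (ℓ := shapes.sup List.length)
    fun _ hw => Finset.le_sup (f := List.length) hw)

/-- **A link derivative of a site term**: `∂_{e',X} s_x ∈ PD ℓ (linkBall (4ℓ) e')` — zero unless `e'` lies in
the support ball of `s_x`, whose links are then within radius `4ℓ` of `e'`. [cite: Luscher2010Trivializing, §4.5(a)] -/
theorem linkDeriv_loopSite_mem (hd : 2 ≤ d) (shapes : Finset (PathWord d)) (coef : PathWord d → ℂ) {ℓ : ℕ}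
    (hℓ : ∀ w ∈ shapes, w.length ≤ ℓ) (e' : Edge d L) (X : Matrix (Fin n) (Fin n) ℂ) (x : Site d L)
    (ν : Fin d) :
    linkDeriv e' X (fun W : AmbConfig d L n => ∑ w ∈ shapes, (coef w * (pathProd W x w).trace).re) ∈
      PD ℓ (linkBall (4 * ℓ) e') := by
  have hs := loopSite_mem (n := n) hd shapes coef hℓ x ν
  by_cases he : e' ∈ linkBall (2 * ℓ) (x, ν)
  · have hsub : linkBall (2 * ℓ) (x, ν) ⊆ linkBall (4 * ℓ) e' := fun e'' h'' =>
      linkBall_mono (by omega) _ (linkBall_add ((mem_linkBall_comm _ _ _).1 he) h'')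
    exact linkDeriv_mem_PD e' X (PD_mono le_rfl hsub hs)
  · rw [linkDeriv_eq_zero_of_not_mem X hs.2 he]
    exact const_mem_PD _ _ 0

/-- **A link derivative of a loop action only sees the loops through nearby links**:
`∂_{e',X} S ∈ PD ℓ (linkBall (4ℓ) e')` (`d ≥ 2`). [cite: Luscher2010Trivializing, §4.5(a)] -/
theorem linkDeriv_loopAction_mem (hd : 2 ≤ d) (shapes : Finset (PathWord d)) (coef : PathWord d → ℂ) {ℓ : ℕ}
    (hℓ : ∀ w ∈ shapes, w.length ≤ ℓ) (e' : Edge d L) (X : Matrix (Fin n) (Fin n) ℂ) :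
    linkDeriv e' X (loopAction shapes coef : AmbConfig d L n → ℝ) ∈ PD ℓ (linkBall (4 * ℓ) e') := by
  rw [loopAction_eq_sum_site, linkDeriv_finset_sum e' X Finset.univ
    (fun x => fun W' : AmbConfig d L n => ∑ w ∈ shapes, (coef w * (pathProd W' x w).trace).re)
    (fun x _ => contDiff_of_mem_PD (loopSite_mem hd shapes coef hℓ x e'.2))]
  have hfn : (fun W => ∑ x : Site d L, linkDeriv e' X
      (fun W' : AmbConfig d L n => ∑ w ∈ shapes, (coef w * (pathProd W' x w).trace).re) W) =
      ∑ x : Site d L, linkDeriv e' X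
        (fun W' : AmbConfig d L n => ∑ w ∈ shapes, (coef w * (pathProd W' x w).trace).re) := by
    funext W; simp only [Finset.sum_apply]
  rw [hfn]
  exact Submodule.sum_mem _ fun x _ => linkDeriv_loopSite_mem hd shapes coef hℓ e' X x e'.2

end

end Summit.Ventures.LatticeQCDFlow.TrivializingMaps
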